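import Mathlib
import Literature.Probability.LatticeModels.LatticeGraph
import Literature.MathematicalPhysics.QuantumFieldTheory.Balaban1983to89.B6Geometry
import Literature.MathematicalPhysics.QuantumFieldTheory.Balaban1983to89.B6Lemma21TowerTorus
import Literature.MathematicalPhysics.QuantumFieldTheory.Balaban1983to89.B1Ineq234Concrete

/-!
# `Balaban1983to89.B6TowerTorusRealizes` — T. Bałaban, *Propagators and renormalization transformations for lattice gauge
theories. II*, Commun. Math. Phys. **96** (1984) 223–250 [Balaban1984PropagatorsII], (2.45)–(2.46) p. 231: **the one-scale
tower-torus geometry REALISES the multiscale distance (2.46)** — on one scale (Λ_k = T₁^{(k)}) the admissible contours of (2.46)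
are chains of unit-torus bonds, and the distance `d(y, y′) = inf_Γ Σ_j (L^jη)⁻¹|Γ ∩ B^j(Λ_j)|` IS the periodic ℓ¹ distance
`|y − y′|₁ = Σ_μ dist(y_μ − y′_μ, Nℤ)` posited as the field `dist := T1` of `B6Prop22OneScaleTorus.oneScaleGeo` (this seat, gen 6)

statement-level skeleton of published theorems with citation tags; proofs where landed; nothing here is a claim about the Yang–Mills mass gap.
PDF held: `paper:balaban1984-cmp96-propagators-rt-ii` (journal page = PDF page + 222); p. 231 [PDF 9] read this lineage (the verbatim
text of (2.45)–(2.46) is the docstring of `B6Geometry.ContourSystem` ∕ `dist246`, certified by the B6 block reader r03).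

CITATION HEADER (cell `lit-balaban`, HOME `run/shared/lean/pub/lit-balaban/`; Phase-2 proof seat `p01` gen 6 = unit `lit-balaban-p01`;
`PHASE2-TARGETS.md` §G, free-target protocol G.5-34(d)).  SKELETON row **`B6.Eq2.45`** ((2.45)–(2.46), DEF row; decls of record
`…89.B6Geometry.ContourSystem`, `dist246`, `Realizes`) of `HOME/lit-balaban-r03/ROWS-B6.md` (owner r03, referee ref-4), kind «model
instance»: after the box models `B6CoverRealizes.boxGeo_realizes` ∕ `tlGeo_realizes` (b06) and the towers `B6LevelTower.twGeo_realizes`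
(realised BY DEFINITION, `rfl`), here a geometry whose distance was posited in CLOSED FORM (the periodic ℓ¹ distance `T1` of the three
gen-6 files `B6Prop22OneScaleTorus` p258648, `B6Lemma21TowerTorus` p260319, `B6Ineq268OneScaleTorus` p260915) is PROVED to realise (2.46).
IMPORTED, NOT MODIFIED: `…B6Geometry` (pv08∕b06: `ContourSystem`, `dist246`, `Realizes`, `Separates`, `LevelGap`, `triangle254_of_realizes`,
`hyps266_of_realizes`, `ineq260_of_levelGap`, `lemma21Printed_of_ineq261`), `…B6Prop22OneScaleTorus` ∕ `…B6Lemma21TowerTorus` (this seat: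
`oneScaleGeo`, `T1`, `Index`, `ineq261_oneScaleGeo`), `Literature.Probability.LatticeModels.LatticeGraph` (`torusGraph` = Mathlib's
circulant nearest-neighbour graph on `(ℤ/N)^n`, `torusGraph_adj_iff`), `…B1Ineq234Concrete` (`circAbs_val_sub`), `…B4Sect5Torus` (`ccoord`),
`…B5Ineq137Torus` (`toT`, `Nv`).

WHAT THE PAPER PRINTS (p. 231 [PDF 9], verbatim): *"Let us define 𝔅 = ⋃_{j=0}^k Λ_j (2.45) … we will consider contours Γ_{y,y′} …
such that a part of Γ contained in B^j(Λ_j) consists of bonds of the lattice Λ_j. Let us define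
d(y, y′) = inf_{Γ_{y,y′}} Σ_{j=0}^{k} (L^jη)^{−1}|Γ_{y,y′} ∩ B^j(Λ_j)| (2.46). Of course the infimum is attained at some contour
Γ_{y,y′}."*; p. 235 [PDF 13]: *"If we have one scale, i.e. Λ_k = T₁^{(k)}, then the operator is a unit lattice operator."*

WHAT IS PROVED HERE (0 `sorry`, 0 named facts; axioms standard).
* §1 (pure combinatorics of the discrete torus `(ℤ/N)^n`, `N ≥ 2`): `cycSum x y = Σ_i min{(x_i − y_i) mod N, (y_i − x_i) mod N}` (the
  periodic ℓ¹ distance); `adj_add_single` (x ∼ x + e_i); `exists_walk_le_cycSum` (a staircase contour of `cycSum x y` bonds joins x to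
  y); `cycSum_le_one_of_adj`, `cycSum_triangle`, `cycSum_le_length` (no contour is shorter: `cycSum` is 1-Lipschitz along bonds);
  **`torusGraph_dist_eq_cycSum`** — the graph distance of the nearest-neighbour torus graph IS the periodic ℓ¹ distance;
  `torusGraph_reachable`, `torusGraph_connected`.
* §2 `T1_eq_torusGraph_dist` — on every torus `T^{(j)} = Site P j` of the lineage, `T1 P j x y` (the distance field of `oneScaleGeo`)
  = the graph distance of the unit-torus bond graph.
* §3 `towerCS P Mb R` — the one-scale tower torus AS A CONTOUR SYSTEM of `B6Geometry` (points = T₁^{(K)}, admissible bonds = unit-torus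
  bonds, one zone K); **`oneScaleGeo_realizes : Realizes (oneScaleGeo P Mb R) (towerCS P Mb R)`**; `towerCS_connected` (*"the infimum
  is attained"*), `towerCS_separates`, `towerCS_levelGap` (one zone: the walk form of (2.2)∕(2.57) holds for every N).
* §4 the metric binders RE-DERIVED BY NAME from the realisation: `oneScaleGeo_hyps266` ((2.54), d(y,y) = 0, d ≥ 0 via
  `hyps266_of_realizes`), and — as `example`s, since the landed declarations are the ones to cite — (2.60) for every α δ₀ ≥ 0 and
  every R, M via `ineq260_of_levelGap` = `B6Lemma21TowerTorus.ineq260_oneScaleGeo`, (2.54) = `B6Lemma21TowerTorus.triangle254_oneScaleGeo` and the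
  VERBATIM `B6.Lemma21Printed` on the family `Index d L` from (2.46) + (2.61) alone (`lemma21Printed_of_ineq261` fed with
  `B6Lemma21TowerTorus.ineq261_oneScaleGeo`) = `B6Lemma21TowerTorus.lemma21Printed_towerTorus`.
HONEST SCOPE.  One scale only (one zone, so (2.2)∕(2.57) are vacuous and (2.60) trivial — the content here is the identification of the
closed-form distance with (2.46)); kernel bookkeeping, no analysis; NOT the k-level statement and NOT summit progress.
-/

namespace Literature.MathematicalPhysics.QuantumFieldTheory.Balaban1983to89.B6TowerTorusRealizes

open Finset
open Literature.Probability.LatticeModels (TorusSite torusGraph torusGraph_adj_iff)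
open B4Sect5Torus (ccoord)
open B5Ineq137Torus (toT Nv)
open B6Prop22OneScaleTorus (T1 oneScaleGeo Index)
open B6Lemma21TowerTorus (triangle254_oneScaleGeo ineq260_oneScaleGeo ineq261_oneScaleGeo lemma21Printed_towerTorus)
open B6Geometry (ContourSystem dist246 Realizes Separates LevelGap triangle254_of_realizes hyps266_of_realizes ineq260_of_levelGap
  lemma21Printed_of_ineq261)
open B6RandomWalk (Ineq260 Ineq261 Triangle254)

/-! ## §1. The nearest-neighbour graph of the discrete torus `(ℤ/N)^n`: graph distance = periodic ℓ¹ distance -/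

section TorusGraphDist

variable {n N : ℕ}

/-- **The periodic ℓ¹ distance** on `(ℤ/N)^n`: `Σ_i min{(x_i − y_i) mod N, (y_i − x_i) mod N} = Σ_i dist(x_i − y_i, Nℤ)` — on one scale
the value of (2.46) (`torusGraph_dist_eq_cycSum`). [cite: Balaban1984PropagatorsII, (2.46) p.231] -/
def cycSum (x y : TorusSite n N) : ℕ := ∑ i, min (x i - y i).val (y i - x i).val

/-- the intermediate corner `x` with the coordinates in `s` already moved to those of `y` (the staircase contour).
[cite: Balaban1984PropagatorsII, (2.46) p.231; bookkeeping] -/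
def mix (s : Finset (Fin n)) (x y : TorusSite n N) : TorusSite n N := fun i => if i ∈ s then y i else x i

/-- `cycSum x x = 0`. [cite: Balaban1984PropagatorsII, (2.46) p.231; bookkeeping] -/
@[simp] theorem cycSum_self (x : TorusSite n N) : cycSum x x = 0 := by
  simp [cycSum]

/-- `cycSum` is symmetric. [cite: Balaban1984PropagatorsII, (2.46) p.231; bookkeeping] -/
theorem cycSum_comm (x y : TorusSite n N) : cycSum x y = cycSum y x := by
  unfold cycSum
  exact Finset.sum_congr rfl fun i _ => min_comm _ _

variable [Fact (1 < N)]

/-- `NeZero N` from `1 < N` (for the `ZMod.val` API). [folklore] -/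
private theorem neZero_N : NeZero N := ⟨by have := (Fact.out : 1 < N); omega⟩

/-- A unit-torus bond: `x ∼ x + e_i` (N ≥ 2, so `x + e_i ≠ x`). [cite: Balaban1984PropagatorsII, (2.46) p.231; bookkeeping] -/
theorem adj_add_single (x : TorusSite n N) (i : Fin n) : (torusGraph n N).Adj x (x + Pi.single i 1) := by
  rw [torusGraph_adj_iff]
  refine ⟨fun h => ?_, Or.inl ⟨i, rfl⟩⟩
  have h1 := congr_fun h i
  simp at h1

/-- `k` bonds in direction `i` join `x` to `x + k·e_i`. [cite: Balaban1984PropagatorsII, (2.46) p.231; bookkeeping] -/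
theorem exists_walk_single (x : TorusSite n N) (i : Fin n) (k : ℕ) :
    ∃ p : (torusGraph n N).Walk x (x + Pi.single i (k : ZMod N)), p.length ≤ k := by
  induction k with
  | zero => exact ⟨SimpleGraph.Walk.nil.copy rfl (by simp), by simp⟩
  | succ k ih =>
    obtain ⟨p, hp⟩ := ih
    have hadj := adj_add_single (x + Pi.single i (k : ZMod N)) i
    refine ⟨(p.concat hadj).copy rfl ?_, ?_⟩
    · rw [add_assoc, ← Pi.single_add, Nat.cast_succ]
    · rw [SimpleGraph.Walk.length_copy, SimpleGraph.Walk.length_concat]; omega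

/-- Moving ONE coordinate of `w` by `c` costs at most `min{c mod N, (−c) mod N}` bonds (go round the circle the shorter way).
[cite: Balaban1984PropagatorsII, (2.46) p.231; bookkeeping] -/
theorem exists_walk_coord (w : TorusSite n N) (i : Fin n) (c : ZMod N) :
    ∃ p : (torusGraph n N).Walk w (w + Pi.single i c), p.length ≤ min c.val (-c).val := by
  haveI := neZero_N (N := N)
  rcases le_total c.val (-c).val with h | h
  · rw [min_eq_left h]
    obtain ⟨p, hp⟩ := exists_walk_single w i c.val
    exact ⟨p.copy rfl (by rw [ZMod.natCast_zmod_val]), by rwa [SimpleGraph.Walk.length_copy]⟩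
  · rw [min_eq_right h]
    obtain ⟨p, hp⟩ := exists_walk_single (w + Pi.single i c) i (-c).val
    refine ⟨(p.copy rfl ?_).reverse, ?_⟩
    · rw [ZMod.natCast_zmod_val, add_assoc, ← Pi.single_add, add_neg_cancel, Pi.single_zero, add_zero]
    · rwa [SimpleGraph.Walk.length_reverse, SimpleGraph.Walk.length_copy]

/-- The staircase contour through the corners `mix s x y`. [cite: Balaban1984PropagatorsII, (2.46) p.231; bookkeeping] -/
theorem exists_walk_mix (x y : TorusSite n N) (s : Finset (Fin n)) :
    ∃ p : (torusGraph n N).Walk x (mix s x y), p.length ≤ ∑ i ∈ s, min (x i - y i).val (y i - x i).val := by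
  classical
  induction s using Finset.induction_on with
  | empty =>
    have hx : mix ∅ x y = x := by funext j; simp [mix]
    exact ⟨SimpleGraph.Walk.nil.copy rfl hx.symm, by rw [SimpleGraph.Walk.length_copy, SimpleGraph.Walk.length_nil, Finset.sum_empty]⟩
  | insert i s hi ih =>
    obtain ⟨p, hp⟩ := ih
    obtain ⟨q, hq⟩ := exists_walk_coord (mix s x y) i (y i - x i)
    have hmix : mix (insert i s) x y = mix s x y + Pi.single i (y i - x i) := by
      funext j
      by_cases hj : j = i
      · subst hj
        simp [mix, hi]
      · simp [mix, hj]
    refine ⟨(p.append q).copy rfl hmix.symm, ?_⟩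
    have hneg : (-(y i - x i)).val = (x i - y i).val := by rw [neg_sub]
    rw [SimpleGraph.Walk.length_copy, SimpleGraph.Walk.length_append, Finset.sum_insert hi, min_comm]
    rw [hneg] at hq
    omega

/-- **A staircase contour realises the periodic ℓ¹ distance**: `x` and `y` are joined by `cycSum x y` unit-torus bonds.
[cite: Balaban1984PropagatorsII, (2.46) p.231] -/
theorem exists_walk_le_cycSum (x y : TorusSite n N) : ∃ p : (torusGraph n N).Walk x y, p.length ≤ cycSum x y := by
  classical
  obtain ⟨p, hp⟩ := exists_walk_mix x y Finset.univ
  exact ⟨p.copy rfl (by funext j; simp [mix]), by rwa [SimpleGraph.Walk.length_copy]⟩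

/-- Admissible contours exist between any two points of the torus (*"Of course the infimum is attained"*).
[cite: Balaban1984PropagatorsII, p.231] -/
theorem torusGraph_reachable (x y : TorusSite n N) : (torusGraph n N).Reachable x y := by
  obtain ⟨p, -⟩ := exists_walk_le_cycSum x y
  exact p.reachable

/-- The nearest-neighbour torus graph is connected (N ≥ 2). [cite: Balaban1984PropagatorsII, p.231; bookkeeping] -/
theorem torusGraph_connected : (torusGraph n N).Connected :=
  (SimpleGraph.connected_iff _).2 ⟨fun x y => torusGraph_reachable x y, ⟨fun _ => 0⟩⟩

/-- A bond has periodic ℓ¹ length at most 1 (exactly one coordinate moves by ±1). [cite: Balaban1984PropagatorsII, (2.46) p.231; bookkeeping] -/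
theorem cycSum_le_one_of_adj {x z : TorusSite n N} (h : (torusGraph n N).Adj x z) : cycSum x z ≤ 1 := by
  unfold cycSum
  rw [torusGraph_adj_iff] at h
  obtain ⟨-, ⟨i, rfl⟩ | ⟨i, rfl⟩⟩ := h
  · rw [Finset.sum_eq_single i (fun j _ hj => by simp [Pi.single_eq_of_ne hj]) (by simp)]
    simp only [Pi.add_apply, Pi.single_eq_same, add_sub_cancel_left, sub_add_cancel_left]
    exact (min_le_right _ _).trans (ZMod.val_one N).le
  · rw [Finset.sum_eq_single i (fun j _ hj => by simp [Pi.single_eq_of_ne hj]) (by simp)]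
    simp only [Pi.add_apply, Pi.single_eq_same, add_sub_cancel_left, sub_add_cancel_left]
    exact (min_le_left _ _).trans (ZMod.val_one N).le

/-- the mixed case of the cyclic triangle inequality: `dist(u + v, Nℤ) ≤ (u mod N) + ((−v) mod N)`. [folklore] -/
private theorem cyc_triangle_aux (u v : ZMod N) : min (u + v).val (-(u + v)).val ≤ u.val + (-v).val := by
  haveI := neZero_N (N := N)
  rcases le_total (-v).val u.val with h | h
  · have hw : u + v = ((u.val - (-v).val : ℕ) : ZMod N) := by
      rw [Nat.cast_sub h, ZMod.natCast_zmod_val, ZMod.natCast_zmod_val, sub_neg_eq_add]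
    have hle : (u + v).val ≤ u.val - (-v).val := by
      rw [hw, ZMod.val_natCast]; exact Nat.mod_le _ _
    exact (min_le_left _ _).trans (by omega)
  · have hw : -(u + v) = (((-v).val - u.val : ℕ) : ZMod N) := by
      rw [Nat.cast_sub h, ZMod.natCast_zmod_val, ZMod.natCast_zmod_val]; ring
    have hle : (-(u + v)).val ≤ (-v).val - u.val := by
      rw [hw, ZMod.val_natCast]; exact Nat.mod_le _ _
    exact (min_le_right _ _).trans (by omega)

/-- the cyclic triangle inequality `dist(a − c, Nℤ) ≤ dist(a − b, Nℤ) + dist(b − c, Nℤ)` in the `ZMod.val` form. [folklore] -/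
private theorem cyc_triangle (a b c : ZMod N) :
    min (a - c).val (c - a).val ≤ min (a - b).val (b - a).val + min (b - c).val (c - b).val := by
  haveI := neZero_N (N := N)
  have key : ∀ u v : ZMod N, min (u + v).val (-(u + v)).val ≤ min u.val (-u).val + min v.val (-v).val := by
    intro u v
    rcases min_choice u.val (-u).val with hu | hu <;> rcases min_choice v.val (-v).val with hv | hv <;> rw [hu, hv]
    · exact (min_le_left _ _).trans (ZMod.val_add_le u v)
    · exact cyc_triangle_aux u v
    · have h := cyc_triangle_aux v u
      rw [add_comm v u] at h
      omega
    · calc min (u + v).val (-(u + v)).val ≤ (-(u + v)).val := min_le_right _ _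
        _ = (-u + -v).val := by rw [neg_add]
        _ ≤ (-u).val + (-v).val := ZMod.val_add_le _ _
  have h := key (a - b) (b - c)
  rwa [sub_add_sub_cancel, neg_sub, neg_sub, neg_sub] at h

/-- **(2.54) for the periodic ℓ¹ distance**, coordinatewise. [cite: Balaban1984PropagatorsII, (2.54) p.233; bookkeeping] -/
theorem cycSum_triangle (x z y : TorusSite n N) : cycSum x y ≤ cycSum x z + cycSum z y := by
  unfold cycSum
  rw [← Finset.sum_add_distrib]
  exact Finset.sum_le_sum fun i _ => cyc_triangle (x i) (z i) (y i)

/-- **No contour is shorter than the periodic ℓ¹ distance**: `cycSum x y ≤ |Γ_{x,y}|` for every chain of unit-torus bonds.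
[cite: Balaban1984PropagatorsII, (2.46) p.231] -/
theorem cycSum_le_length {x y : TorusSite n N} (p : (torusGraph n N).Walk x y) : cycSum x y ≤ p.length := by
  induction p with
  | nil => simp
  | cons h q ih =>
    rw [SimpleGraph.Walk.length_cons]
    calc cycSum _ _ ≤ cycSum _ _ + cycSum _ _ := cycSum_triangle _ _ _
      _ ≤ 1 + q.length := add_le_add (cycSum_le_one_of_adj h) ih
      _ = q.length + 1 := add_comm _ _

/-- **The graph distance of the nearest-neighbour torus graph `(ℤ/N)^n` (N ≥ 2) IS the periodic ℓ¹ distance** — on one scale the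
infimum (2.46) over admissible contours equals `Σ_μ dist(y_μ − y′_μ, Nℤ)`. [cite: Balaban1984PropagatorsII, (2.46) p.231] -/
theorem torusGraph_dist_eq_cycSum (x y : TorusSite n N) : (torusGraph n N).dist x y = cycSum x y := by
  obtain ⟨p, hp⟩ := exists_walk_le_cycSum x y
  refine le_antisymm ((SimpleGraph.dist_le p).trans hp) ?_
  obtain ⟨q, hq⟩ := p.reachable.exists_walk_length_eq_dist
  rw [← hq]
  exact cycSum_le_length q

end TorusGraphDist

/-! ## §2. The distance field `T1` of the one-scale tower torus = the graph distance of the unit-torus bond graph -/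

section Lineage

variable (P : Params)

/-- The circular coordinate distance of the lineage (`B4Sect5Torus.ccoord` through `B5Ineq137Torus.toT`) in the `ZMod.val` form.
[cite: Balaban1984PropagatorsII, p.223 (the distance |x − y|); bookkeeping] -/
theorem ccoord_toT_eq (j : ℕ) (x y : Site P j) (μ : Fin P.d) :
    ccoord (Nv P j) (toT x) (toT y) μ = min (x μ - y μ).val (y μ - x μ).val := by
  simp only [ccoord, toT, Nv]
  exact B1Ineq234Concrete.circAbs_val_sub (x μ) (y μ)

/-- **`T1 = d` of (2.46) on one scale**: the periodic ℓ¹ distance `T1 P j` on `T^{(j)} = Site P j` is the graph distance of the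
unit-torus bond graph (`torusGraph P.d (2L^{m+K−j})`). [cite: Balaban1984PropagatorsII, (2.46) p.231] -/
theorem T1_eq_torusGraph_dist (j : ℕ) (x y : Site P j) :
    T1 P j x y = (((torusGraph P.d (P.sitesPerDir j)).dist x y : ℕ) : ℝ) := by
  unfold T1
  rw [torusGraph_dist_eq_cycSum]
  unfold cycSum
  congr 1
  exact Finset.sum_congr rfl fun μ _ => ccoord_toT_eq P j x y μ

/-! ## §3. The one-scale tower torus as a contour system; it REALISES (2.46) -/

/-- **The one-scale tower torus as a contour system of (2.46)**: lattice points = `T₁^{(K)} = Site P K` (𝔅 = Λ_K, ι = id), admissible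
bonds = the unit-torus bonds (*"a part of Γ contained in B^k(Λ_k) consists of bonds of the lattice Λ_k"*, each of weight
`(L^kη)⁻¹·L^kη = 1`), every point in zone K. [cite: Balaban1984PropagatorsII, (2.45)–(2.46) p.231] -/
def towerCS (Mb R : ℕ) : ContourSystem (oneScaleGeo P Mb R) where
  Pt := Site P P.K
  bond := torusGraph P.d (P.sitesPerDir P.K)
  ι := fun y => y
  zone := fun _ => P.K
  zone_ι := fun _ => rfl

/-- **`oneScaleGeo` REALISES (2.46)**: its posited distance `T1` (periodic ℓ¹) is the length of a shortest admissible contour.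
[cite: Balaban1984PropagatorsII, (2.46) p.231] -/
theorem oneScaleGeo_realizes (Mb R : ℕ) : Realizes (oneScaleGeo P Mb R) (towerCS P Mb R) :=
  fun y y' => T1_eq_torusGraph_dist P P.K y y'

/-- Admissible contours exist (*"the infimum is attained at some contour Γ_{y,y′}"*). [cite: Balaban1984PropagatorsII, p.231] -/
theorem towerCS_connected (Mb R : ℕ) : (towerCS P Mb R).bond.Connected := torusGraph_connected

/-- The zones of the two ends of a bond differ by at most one (trivially: one zone). [cite: Balaban1984PropagatorsII, p.231] -/
theorem towerCS_separates (Mb R : ℕ) : Separates (towerCS P Mb R).bond (towerCS P Mb R).zone :=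
  fun _ _ _ => ⟨Nat.le_succ _, Nat.le_succ _⟩

/-- The walk form of (2.2)∕(2.57) holds for EVERY N on one scale (no contour crosses two surfaces Σ — there are none).
[cite: Balaban1984PropagatorsII, (2.57) p.233] -/
theorem towerCS_levelGap (Mb R N : ℕ) : LevelGap (towerCS P Mb R).bond (towerCS P Mb R).zone N :=
  fun _ _ _ hu hx _ => absurd (hu.trans hx) (lt_irrefl _)

/-! ## §4. The metric binders of the lineage RE-DERIVED BY NAME from the realisation -/

/-- (2.54), d(y,y) = 0 and d ≥ 0 on the one-scale tower torus, from (2.46) (`hyps266_of_realizes`).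
[cite: Balaban1984PropagatorsII, (2.54) p.233 + (2.46) p.231] -/
theorem oneScaleGeo_hyps266 (Mb R : ℕ) :
    Triangle254 (oneScaleGeo P Mb R) ∧ (∀ y, (oneScaleGeo P Mb R).dist y y = 0) ∧ (∀ y y', 0 ≤ (oneScaleGeo P Mb R).dist y y') :=
  hyps266_of_realizes (oneScaleGeo_realizes P Mb R) (towerCS_connected P Mb R)

/- (2.54) re-derived from the realisation is the SAME proposition (and by proof irrelevance the same proof) as the hand-proved
`B6Lemma21TowerTorus.triangle254_oneScaleGeo` — an `example`, the landed declaration being the one to cite.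
[cite: Balaban1984PropagatorsII, (2.54) p.233] -/
example (Mb R : ℕ) : triangle254_of_realizes (oneScaleGeo_realizes P Mb R) (towerCS_connected P Mb R) =
    triangle254_oneScaleGeo P Mb R := rfl

/- **(2.60) on the one-scale tower torus for every α δ₀ with αδ₀ ≥ 0 and every R, M**, from (2.46) and the walk form of (2.2)
(`ineq260_of_levelGap` with N := R·M): the same proposition as the landed `B6Lemma21TowerTorus.ineq260_oneScaleGeo` (an `example`;
the landed declaration is the one to cite). [cite: Balaban1984PropagatorsII, (2.60) p.234] -/
example (Mb R : ℕ) {δ₀ α : ℝ} (hαδ : 0 ≤ α * δ₀) : Ineq260 (oneScaleGeo P Mb R) δ₀ α :=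
  ineq260_of_levelGap (oneScaleGeo_realizes P Mb R) (towerCS_connected P Mb R) (towerCS_levelGap P Mb R (R * Mb))
    (by rw [Nat.cast_mul]) hαδ

example (Mb R : ℕ) {δ₀ α : ℝ} (hαδ : 0 ≤ α * δ₀) :
    ineq260_of_levelGap (oneScaleGeo_realizes P Mb R) (towerCS_connected P Mb R) (towerCS_levelGap P Mb R (R * Mb))
      (by rw [Nat.cast_mul]) hαδ = ineq260_oneScaleGeo P Mb R hαδ := rfl

/- **Lemma 2.1 VERBATIM on the family from (2.46) + (2.61) alone** (`lemma21Printed_of_ineq261` fed with the realisations and the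
lattice count `B6Lemma21TowerTorus.ineq261_oneScaleGeo`): the same proposition as the landed `B6Lemma21TowerTorus.lemma21Printed_towerTorus`.
[cite: Balaban1984PropagatorsII, Lemma 2.1 p.234] -/
example (d L : ℕ) {δ₀ : ℝ} (hδ₀ : 0 < δ₀) : B6.Lemma21Printed d δ₀ (fun i : Index d L => oneScaleGeo i.P i.Mb i.R) :=
  lemma21Printed_of_ineq261 d δ₀ hδ₀.le (fun i : Index d L => oneScaleGeo i.P i.Mb i.R) (fun i => towerCS i.P i.Mb i.R)
    (fun i => i.R * i.Mb) (fun i => oneScaleGeo_realizes i.P i.Mb i.R) (fun i => towerCS_connected i.P i.Mb i.R)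
    (fun i => towerCS_levelGap i.P i.Mb i.R _) (fun i => by rw [Nat.cast_mul])
    (fun i _ α hα0 _ _ => ineq261_oneScaleGeo i.P i.hPd i.Mb i.R (mul_pos hα0 hδ₀))

example (d L : ℕ) {δ₀ : ℝ} (hδ₀ : 0 < δ₀) :
    lemma21Printed_of_ineq261 d δ₀ hδ₀.le (fun i : Index d L => oneScaleGeo i.P i.Mb i.R) (fun i => towerCS i.P i.Mb i.R)
      (fun i => i.R * i.Mb) (fun i => oneScaleGeo_realizes i.P i.Mb i.R) (fun i => towerCS_connected i.P i.Mb i.R)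
      (fun i => towerCS_levelGap i.P i.Mb i.R _) (fun i => by rw [Nat.cast_mul])
      (fun i _ α hα0 _ _ => ineq261_oneScaleGeo i.P i.hPd i.Mb i.R (mul_pos hα0 hδ₀)) =
    lemma21Printed_towerTorus d L hδ₀ := rfl

end Lineage

end Literature.MathematicalPhysics.QuantumFieldTheory.Balaban1983to89.B6TowerTorusRealizes
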